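import Summits.QuantumFields.YangMills.Theorems.PoincareLipschitzOrbitMinLeungXinTransfer
import Summits.QuantumFields.YangMills.Theorems.PoincareLipschitzLeungXinTwistedGraphStability
import Summits.QuantumFields.YangMills.Theorems.LocalInsertionBoxAxialLipschitz
import HarnessLib

/-!
# Crux `HistoryTailL` (stmt-QuantumFields-19936), K2 organ of record «LOC-REG-MIN» (`hReg`; route crux `PoincareLipschitz.BlockLipschitzL`,
# stmt-QuantumFields-23533): THE STABILITY ENERGY BOUND AT A BOX-`ℓ²`-ORBIT MINIMISER, IN THE TOWER'S LETTERS

Cell `ym3-torus` (YM ladder rung R3 = continuum SU(2) Yang–Mills on T³ — a RUNG, NOT the Clay problem: not d = 4, not infinite volume, not a mass gap);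
width seat `ym-ust-19936-w2` g11, F6 pen (LEAD `ym-ust-19936-w1` g8: «stability half of the organ as THEOREMS»).  Helper `--supports stmt-QuantumFields-19936`;
THEOREMS ONLY (0 `def`, 0 `sorry`), `Params`-generic, definition-free.

THE KNIT.  At a gauge transformation `h` minimising the box-`ℓ²` orbit energy `k′ ↦ Σ_{b∈S} dist1(V_b·((W^h)^{k′})_b⁻¹)²` (hReg's clause, any finite bond set
`S`), on a K1 box `{y : (y_k − x₀_k).val < n ∀k}` (corner `x₀`, side `n`, `2n ≤ sitesPerDir`) where BOTH fields have plaquettes within `δ` of `1`: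
  `Σ_{b ∈ S, plateau} dist1(V_b·(W^h)_b⁻¹)² ≤ 6·(d·n^d)·(s⁻² + (4(d−1)(n−1)δ)²)`,
the plateau being the bonds whose endpoints have all offsets in `[a + s, c − s]` (`1 ≤ a`, `c + 1 ≤ n`, `1 ≤ s`).  Assembly of landed letters ONLY:
(1) REGAUGE: axial gauges `g₁, g₂` of `V, W` on the box (lit ✓`T4AxialGaugeSmallField` via ✓`LocalInsertionBoxAxialLipschitz.mem_boxBonds_of_val_lt`:
every box bond of `V^{g₁}, W^{g₂}` within `C = (d−1)(n−1)δ` of `1`), `h′ := g₁hg₂⁻¹`; orbit energy and minimality are conjugation invariant bondwise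
(§1 `dist1_regauge`, `dist1_regauge_one`).  (2) ✓`PoincareLipschitzOrbitMinLeungXinTransfer.leungXin_inputs_of_orbitMin` on `(V^{g₁}, W^{g₂}, S, h′)`:
orthogonal twists `S_b` with defect `≤ 8(C² + C²) = (4C)²` on box bonds, the energy identity, and ★w8's `hmin` for every cutoff.  (3) the product
cutoff `η(y) = Π_k ψ((y_k − x₀_k).val)`, `ψ(o) = max(0, min(1, (o−a)∕s, (c−o)∕s))` (`= 1` on the plateau, `= 0` off the open box `(a, c)^d`, bond
increments `≤ 1∕s` — also across the torus seam, where both values vanish).  (4) ★w8's ✓`PoincareLipschitzLeungXinTwistedGraphStability.sum_energy_le_of_cutoff`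
on the graph `↥S` with `D :=` the box bonds (`#D ≤ d·n^d`, ✓`card_filter_bond_box_le`), `κ := 1∕s`, `δ := 4C`, `A :=` the plateau.

WHAT IS PROVED (ns `…Theorems.PoincareLipschitzOrbitMinBoxEnergy`).
* §1 `dist1_regauge`, `dist1_regauge_one` (conjugation invariance of the orbit-energy bond term under `V ↦ V^{g₁}`, `W ↦ W^{g₂}`, `h ↦ g₁hg₂⁻¹`,
  `k ↦ g₁kg₁⁻¹`); `abs_clamp_succ_sub_le`, `clamp_eq_one`, `clamp_eq_zero_of_le`, `clamp_eq_zero_of_ge`, `clamp_nonneg`, `clamp_le_one` (the 1-D tent);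
  `val_add_one` (the offset along a bond).
* §2 ★★★ `orbitMin_plateau_energy_le` (the display above).
* §3 (v1.1 append) exports by name: `orbitMin_regauge` (regauged minimality), `dist1_gaugeAct_axialGauge_box_le` (axial K1-box gauge, any `GaugeGroup`).
HONEST SCOPE.  Bookkeeping over landed letters; the ε-regularity of LOC-REG-MIN (its residue of record: «quantitative energy improvement at bounded normalised
energy for lattice minimisers into S³») is NOT here; nothing of stmt-QuantumFields-23533 ∕ 19936 is closed.  YM₃ on T³ is rung R3, not Clay; YM gap NOT proved.

References: T. Bałaban, CMP 109 (1987) 249–301 [Balaban1987RG1] ((0.14), (0.18) pp.254–255); CMP 98 (1985) 17–51 [Balaban1985Averaging] ((19)–(20) p.21: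
axial gauge); Y. L. Xin, Duke Math. J. 47 (1980) 609–613 [Xin1980].
-/

set_option autoImplicit false

noncomputable section

open scoped BigOperators ComplexConjugate Matrix.Norms.L2Operator
open Matrix

namespace Summit.QuantumFields.YangMills.Theorems.PoincareLipschitzOrbitMinBoxEnergy

open Literature.MathematicalPhysics.QuantumFieldTheory.Balaban1983to89
open Literature.MathematicalPhysics.QuantumFieldTheory.Balaban1983to89.T4AxialGaugeSmallField
  (boxPlaqs boxBonds axialGauge dist1_gaugeAct_axialGauge_le_of_mem_boxBonds)
open Summit.QuantumFields.YangMills.Theorems.LocalInsertion.BoxAxialLipschitz (mem_boxBonds_of_val_lt val_lt_of_mem_boxPlaqs card_filter_bond_box_le)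
open Summit.QuantumFields.YangMills.Theorems.PoincareLipschitzSU2SphereDictionary (coords_dot_self)
open Summit.QuantumFields.YangMills.Theorems.PoincareLipschitzOrbitMinLeungXinTransfer (leungXin_inputs_of_orbitMin)
open Summit.QuantumFields.YangMills.Theorems.PoincareLipschitzLeungXinTwistedGraphStability (sum_energy_le_of_cutoff)

variable {P : Params} {i : ℕ}

/-! ## §1 Letters -/

/-- **REGAUGING IS A CONJUGATION, BONDWISE**: `dist1(V^{g₁}_b·(((W^{g₂})^{g₁hg₂⁻¹})^{k})_b⁻¹) = dist1(V_b·((W^h)^{g₁⁻¹kg₁})_b⁻¹)`.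
[cite: Balaban1985Averaging, (8) p.19] -/
theorem dist1_regauge (g₁ g₂ h k : GaugeTransf P i (Matrix.specialUnitaryGroup (Fin 2) ℂ))
    (V W : GaugeField P i (Matrix.specialUnitaryGroup (Fin 2) ℂ)) (b : PBond P i) :
    GaugeGroup.dist1 (GaugeField.gaugeAct g₁ V b *
        (GaugeField.gaugeAct k (GaugeField.gaugeAct (fun x => g₁ x * h x * (g₂ x)⁻¹) (GaugeField.gaugeAct g₂ W)) b)⁻¹) =
      GaugeGroup.dist1 (V b * (GaugeField.gaugeAct (fun x => (g₁ x)⁻¹ * k x * g₁ x) (GaugeField.gaugeAct h W) b)⁻¹) := by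
  show GaugeGroup.dist1 (g₁ b.src * V b * (g₁ b.tgt)⁻¹ *
      (k b.src * ((g₁ b.src * h b.src * (g₂ b.src)⁻¹) * (g₂ b.src * W b * (g₂ b.tgt)⁻¹) * (g₁ b.tgt * h b.tgt * (g₂ b.tgt)⁻¹)⁻¹) * (k b.tgt)⁻¹)⁻¹) =
    GaugeGroup.dist1 (V b * (((g₁ b.src)⁻¹ * k b.src * g₁ b.src) * (h b.src * W b * (h b.tgt)⁻¹) * ((g₁ b.tgt)⁻¹ * k b.tgt * g₁ b.tgt)⁻¹)⁻¹)
  rw [show g₁ b.src * V b * (g₁ b.tgt)⁻¹ *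
      (k b.src * ((g₁ b.src * h b.src * (g₂ b.src)⁻¹) * (g₂ b.src * W b * (g₂ b.tgt)⁻¹) * (g₁ b.tgt * h b.tgt * (g₂ b.tgt)⁻¹)⁻¹) * (k b.tgt)⁻¹)⁻¹ =
      g₁ b.src * (V b * (((g₁ b.src)⁻¹ * k b.src * g₁ b.src) * (h b.src * W b * (h b.tgt)⁻¹) * ((g₁ b.tgt)⁻¹ * k b.tgt * g₁ b.tgt)⁻¹)⁻¹) *
        (g₁ b.src)⁻¹ by group, GaugeGroup.dist1_conj]

/-- The same with no competitor: `dist1(V^{g₁}_b·((W^{g₂})^{g₁hg₂⁻¹})_b⁻¹) = dist1(V_b·(W^h)_b⁻¹)`. [cite: Balaban1985Averaging, (8) p.19] -/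
theorem dist1_regauge_one (g₁ g₂ h : GaugeTransf P i (Matrix.specialUnitaryGroup (Fin 2) ℂ))
    (V W : GaugeField P i (Matrix.specialUnitaryGroup (Fin 2) ℂ)) (b : PBond P i) :
    GaugeGroup.dist1 (GaugeField.gaugeAct g₁ V b *
        (GaugeField.gaugeAct (fun x => g₁ x * h x * (g₂ x)⁻¹) (GaugeField.gaugeAct g₂ W) b)⁻¹) =
      GaugeGroup.dist1 (V b * (GaugeField.gaugeAct h W b)⁻¹) := by
  show GaugeGroup.dist1 (g₁ b.src * V b * (g₁ b.tgt)⁻¹ *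
      ((g₁ b.src * h b.src * (g₂ b.src)⁻¹) * (g₂ b.src * W b * (g₂ b.tgt)⁻¹) * (g₁ b.tgt * h b.tgt * (g₂ b.tgt)⁻¹)⁻¹)⁻¹) =
    GaugeGroup.dist1 (V b * (h b.src * W b * (h b.tgt)⁻¹)⁻¹)
  rw [show g₁ b.src * V b * (g₁ b.tgt)⁻¹ *
      ((g₁ b.src * h b.src * (g₂ b.src)⁻¹) * (g₂ b.src * W b * (g₂ b.tgt)⁻¹) * (g₁ b.tgt * h b.tgt * (g₂ b.tgt)⁻¹)⁻¹)⁻¹ =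
      g₁ b.src * (V b * (h b.src * W b * (h b.tgt)⁻¹)⁻¹) * (g₁ b.src)⁻¹ by group, GaugeGroup.dist1_conj]

/-- The tent is in `[0, 1]`, lower end. [folklore] -/
theorem clamp_nonneg (a c : ℕ) (s : ℝ) (o : ℕ) : 0 ≤ max 0 (min 1 (min (((o : ℝ) - a) / s) (((c : ℝ) - o) / s))) := le_max_left _ _

/-- The tent is in `[0, 1]`, upper end. [folklore] -/
theorem clamp_le_one (a c : ℕ) (s : ℝ) (o : ℕ) : max 0 (min 1 (min (((o : ℝ) - a) / s) (((c : ℝ) - o) / s))) ≤ 1 :=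
  max_le zero_le_one (min_le_left _ _)

/-- The tent is `1` on the plateau `a + s ≤ o`, `o + s ≤ c`. [folklore] -/
theorem clamp_eq_one (a c : ℕ) {s : ℝ} (hs : 0 < s) {o : ℕ} (h1 : (a : ℝ) + s ≤ o) (h2 : (o : ℝ) + s ≤ c) :
    max 0 (min 1 (min (((o : ℝ) - a) / s) (((c : ℝ) - o) / s))) = 1 := by
  have e1 : 1 ≤ ((o : ℝ) - a) / s := by rw [le_div_iff₀ hs]; linarith
  have e2 : 1 ≤ ((c : ℝ) - o) / s := by rw [le_div_iff₀ hs]; linarith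
  rw [min_eq_left (le_min e1 e2), max_eq_right zero_le_one]

/-- The tent vanishes below `a`. [folklore] -/
theorem clamp_eq_zero_of_le (a c : ℕ) {s : ℝ} (hs : 0 < s) {o : ℕ} (h : o ≤ a) :
    max 0 (min 1 (min (((o : ℝ) - a) / s) (((c : ℝ) - o) / s))) = 0 := by
  have e1 : ((o : ℝ) - a) / s ≤ 0 := div_nonpos_of_nonpos_of_nonneg (by have hh : (o : ℝ) ≤ a := (by exact_mod_cast h); linarith) hs.le
  exact max_eq_left ((min_le_right _ _).trans ((min_le_left _ _).trans e1))

/-- The tent vanishes above `c`. [folklore] -/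
theorem clamp_eq_zero_of_ge (a c : ℕ) {s : ℝ} (hs : 0 < s) {o : ℕ} (h : c ≤ o) :
    max 0 (min 1 (min (((o : ℝ) - a) / s) (((c : ℝ) - o) / s))) = 0 := by
  have e1 : ((c : ℝ) - o) / s ≤ 0 := div_nonpos_of_nonpos_of_nonneg (by have hh : (c : ℝ) ≤ o := (by exact_mod_cast h); linarith) hs.le
  exact max_eq_left ((min_le_right _ _).trans ((min_le_right _ _).trans e1))

/-- The tent is `1∕s`-Lipschitz along unit steps. [folklore] -/
theorem abs_clamp_succ_sub_le (a c : ℕ) {s : ℝ} (hs : 0 < s) (o : ℕ) :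
    |max 0 (min 1 (min ((((o + 1 : ℕ) : ℝ) - a) / s) (((c : ℝ) - ((o + 1 : ℕ) : ℝ)) / s))) -
        max 0 (min 1 (min (((o : ℝ) - a) / s) (((c : ℝ) - o) / s)))| ≤ 1 / s := by
  refine (abs_max_sub_max_le_max _ _ _ _).trans (max_le (by simp [hs.le]) ?_)
  refine (abs_min_sub_min_le_max _ _ _ _).trans (max_le (by simp [hs.le]) ?_)
  refine (abs_min_sub_min_le_max _ _ _ _).trans (max_le ?_ ?_)
  · rw [show (((o + 1 : ℕ) : ℝ) - a) / s - ((o : ℝ) - a) / s = 1 / s by push_cast; ring]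
    rw [abs_of_nonneg (by positivity)]
  · rw [show ((c : ℝ) - ((o + 1 : ℕ) : ℝ)) / s - ((c : ℝ) - o) / s = -(1 / s) by push_cast; ring]
    rw [abs_neg, abs_of_nonneg (by positivity)]

/-- The offset along a bond: `((z + 1).val = z.val + 1` unless `z.val + 1 = N`, when it is `0`). [folklore] -/
theorem val_add_one {N : ℕ} [NeZero N] (hN : 1 < N) (z : ZMod N) :
    (z + 1).val = if z.val + 1 < N then z.val + 1 else 0 := by
  have : Fact (1 < N) := ⟨hN⟩
  rw [ZMod.val_add, ZMod.val_one]
  split_ifs with hlt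
  · exact Nat.mod_eq_of_lt hlt
  · have hz := ZMod.val_lt z
    rw [show z.val + 1 = N by omega, Nat.mod_self]

/-! ## §2 The stability energy bound at a box-`ℓ²`-orbit minimiser -/

set_option maxHeartbeats 400000 in
/-- ★★★ **THE STABILITY ENERGY BOUND IN THE TOWER'S LETTERS.**  At a gauge transformation `h` minimising the box-`ℓ²` orbit energy over `S` (hReg's clause),
on a K1 box of side `n` about `x₀` (`2n ≤ sitesPerDir`) where both fields are plaquette-`δ`-small, the orbit energy of the plateau bonds (all endpoint
offsets in `[a + s, c − s]`, `1 ≤ a`, `c + 1 ≤ n`, `1 ≤ s`) is at most `6·(d·n^d)·(s⁻² + (4(d−1)(n−1)δ)²)` — stability alone, no closeness of `V, W`,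
no smallness of the data. [cite: Balaban1987RG1, (0.14) p.254; Xin1980] -/
theorem orbitMin_plateau_energy_le [DecidableEq (PBond P i)]
    (V W : GaugeField P i (Matrix.specialUnitaryGroup (Fin 2) ℂ)) (S : Finset (PBond P i))
    (h : GaugeTransf P i (Matrix.specialUnitaryGroup (Fin 2) ℂ))
    (hmin : ∀ k' : GaugeTransf P i (Matrix.specialUnitaryGroup (Fin 2) ℂ),
      (∑ b : PBond P i, if b ∈ S then GaugeGroup.dist1 (V b * (GaugeField.gaugeAct h W b)⁻¹) ^ 2 else 0) ≤
        ∑ b : PBond P i, if b ∈ S then GaugeGroup.dist1 (V b * (GaugeField.gaugeAct k' (GaugeField.gaugeAct h W) b)⁻¹) ^ 2 else 0)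
    (x₀ : Site P i) {n a c s : ℕ} (h2n : 2 * n ≤ P.sitesPerDir i) (ha : 1 ≤ a) (hcn : c + 1 ≤ n) (hs : 1 ≤ s)
    {δ : ℝ} (hδ : 0 ≤ δ)
    (hV : ∀ q : Plaq P i, (∀ k, (q.src k - x₀ k).val < n) → GaugeGroup.dist1 (GaugeField.plaqHol V q) < δ)
    (hW : ∀ q : Plaq P i, (∀ k, (q.src k - x₀ k).val < n) → GaugeGroup.dist1 (GaugeField.plaqHol W q) < δ) :
    ∑ b ∈ S.filter (fun b => ∀ k, a + s ≤ (b.src k - x₀ k).val ∧ (b.src k - x₀ k).val + s ≤ c ∧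
        a + s ≤ (b.tgt k - x₀ k).val ∧ (b.tgt k - x₀ k).val + s ≤ c),
      GaugeGroup.dist1 (V b * (GaugeField.gaugeAct h W b)⁻¹) ^ 2 ≤
      6 * ((P.d * n ^ P.d : ℕ) : ℝ) * ((1 / (s : ℝ)) ^ 2 + (4 * ((((P.d - 1 : ℕ) : ℝ)) * (((n - 1 : ℕ) : ℝ)) * δ)) ^ 2) := by
  classical
  have hn : 1 ≤ n := by omega
  have hN1 : 1 < P.sitesPerDir i := by omega
  have hs0 : (0 : ℝ) < s := by exact_mod_cast hs
  -- (1) the axial gauges on the integer box `[lo, lo + (n-1)]`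
  set lo : Fin P.d → ℤ := fun κ => ((x₀ κ).val : ℤ) with hlo
  set hi : Fin P.d → ℤ := fun κ => ((x₀ κ).val : ℤ) + ((n - 1 : ℕ) : ℤ) with hhi
  have hnle : ∀ κ, hi κ ≤ lo κ + ((n - 1 : ℕ) : ℤ) := fun κ => le_rfl
  have hnN : n - 1 < P.sitesPerDir i := by omega
  have hsmallV : PlaqSmallOn (boxPlaqs lo hi) δ V := fun q hq => hV q (val_lt_of_mem_boxPlaqs x₀ hn h2n hq)
  have hsmallW : PlaqSmallOn (boxPlaqs lo hi) δ W := fun q hq => hW q (val_lt_of_mem_boxPlaqs x₀ hn h2n hq)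
  set g₁ : GaugeTransf P i (Matrix.specialUnitaryGroup (Fin 2) ℂ) := axialGauge V lo hi with hg₁
  set g₂ : GaugeTransf P i (Matrix.specialUnitaryGroup (Fin 2) ℂ) := axialGauge W lo hi with hg₂
  set C : ℝ := (((P.d - 1 : ℕ) : ℝ)) * (((n - 1 : ℕ) : ℝ)) * δ with hC
  have hC0 : 0 ≤ C := by positivity
  have hbondV : ∀ b : PBond P i, (∀ k, (b.src k - x₀ k).val < n) → (∀ k, (b.tgt k - x₀ k).val < n) →
      GaugeGroup.dist1 (GaugeField.gaugeAct g₁ V b) ≤ C := by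
    intro b hsb htb
    have h0 := dist1_gaugeAct_axialGauge_le_of_mem_boxBonds V subset_rfl hsmallV hδ hnle hnN (mem_boxBonds_of_val_lt x₀ hn h2n b hsb htb)
    simpa [hg₁, hC, mul_assoc] using h0
  have hbondW : ∀ b : PBond P i, (∀ k, (b.src k - x₀ k).val < n) → (∀ k, (b.tgt k - x₀ k).val < n) →
      GaugeGroup.dist1 (GaugeField.gaugeAct g₂ W b) ≤ C := by
    intro b hsb htb
    have h0 := dist1_gaugeAct_axialGauge_le_of_mem_boxBonds W subset_rfl hsmallW hδ hnle hnN (mem_boxBonds_of_val_lt x₀ hn h2n b hsb htb)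
    simpa [hg₂, hC, mul_assoc] using h0
  -- (2) the regauged triple is again a box-ℓ²-orbit minimiser (conjugation invariance, bondwise)
  set h' : GaugeTransf P i (Matrix.specialUnitaryGroup (Fin 2) ℂ) := fun x => g₁ x * h x * (g₂ x)⁻¹ with hh'
  have hmin' : ∀ k' : GaugeTransf P i (Matrix.specialUnitaryGroup (Fin 2) ℂ),
      (∑ b : PBond P i, if b ∈ S then GaugeGroup.dist1 (GaugeField.gaugeAct g₁ V b *
          (GaugeField.gaugeAct h' (GaugeField.gaugeAct g₂ W) b)⁻¹) ^ 2 else 0) ≤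
        ∑ b : PBond P i, if b ∈ S then GaugeGroup.dist1 (GaugeField.gaugeAct g₁ V b *
          (GaugeField.gaugeAct k' (GaugeField.gaugeAct h' (GaugeField.gaugeAct g₂ W)) b)⁻¹) ^ 2 else 0 := by
    intro k'
    have e1 : ∀ b : PBond P i, GaugeGroup.dist1 (GaugeField.gaugeAct g₁ V b * (GaugeField.gaugeAct h' (GaugeField.gaugeAct g₂ W) b)⁻¹) =
        GaugeGroup.dist1 (V b * (GaugeField.gaugeAct h W b)⁻¹) := fun b => dist1_regauge_one g₁ g₂ h V W b
    have e2 : ∀ b : PBond P i, GaugeGroup.dist1 (GaugeField.gaugeAct g₁ V b *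
        (GaugeField.gaugeAct k' (GaugeField.gaugeAct h' (GaugeField.gaugeAct g₂ W)) b)⁻¹) =
        GaugeGroup.dist1 (V b * (GaugeField.gaugeAct (fun x => (g₁ x)⁻¹ * k' x * g₁ x) (GaugeField.gaugeAct h W) b)⁻¹) :=
      fun b => dist1_regauge g₁ g₂ h k' V W b
    simp only [e1, e2]
    exact hmin _
  -- (3) the transfer
  obtain ⟨Sm, hSm, hdef, hE, hLX⟩ := leungXin_inputs_of_orbitMin (GaugeField.gaugeAct g₁ V) (GaugeField.gaugeAct g₂ W) S h' hmin'
  -- (4) the product cutoff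
  set ψ : ℕ → ℝ := fun o => max 0 (min 1 (min (((o : ℝ) - a) / s) (((c : ℝ) - o) / s))) with hψ
  set η : Site P i → ℝ := fun y => ∏ k : Fin P.d, ψ ((y k - x₀ k).val) with hη
  have hψ0 : ∀ o, 0 ≤ ψ o := fun o => clamp_nonneg a c s o
  have hψ1 : ∀ o, ψ o ≤ 1 := fun o => clamp_le_one a c s o
  have hη0 : ∀ y, 0 ≤ η y := fun y => Finset.prod_nonneg fun k _ => hψ0 _
  have hη1 : ∀ y, η y ≤ 1 := fun y => Finset.prod_le_one (fun k _ => hψ0 _) fun k _ => hψ1 _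
  have hoff_ne : ∀ (b : PBond P i) (k : Fin P.d), k ≠ b.dir → b.tgt k - x₀ k = b.src k - x₀ k := by
    intro b k hk; rw [PBond.tgt, Site.shift_apply, if_neg hk]
  have hoff_dir : ∀ b : PBond P i, (b.tgt b.dir - x₀ b.dir).val =
      if (b.src b.dir - x₀ b.dir).val + 1 < P.sitesPerDir i then (b.src b.dir - x₀ b.dir).val + 1 else 0 := by
    intro b
    rw [show b.tgt b.dir - x₀ b.dir = (b.src b.dir - x₀ b.dir) + 1 by rw [PBond.tgt, Site.shift_apply, if_pos rfl]; ring, val_add_one hN1]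
  have hψstep : ∀ b : PBond P i, |ψ ((b.src b.dir - x₀ b.dir).val) - ψ ((b.tgt b.dir - x₀ b.dir).val)| ≤ 1 / s := by
    intro b
    rw [hoff_dir]
    split_ifs with hlt
    · rw [abs_sub_comm]; exact abs_clamp_succ_sub_le a c hs0 _
    · have hv := ZMod.val_lt (b.src b.dir - x₀ b.dir)
      have hbig : c ≤ (b.src b.dir - x₀ b.dir).val := by omega
      rw [show ψ ((b.src b.dir - x₀ b.dir).val) = 0 from clamp_eq_zero_of_ge a c hs0 hbig,
        show ψ 0 = 0 from clamp_eq_zero_of_le a c hs0 (Nat.zero_le a), sub_self, abs_zero]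
      positivity
  have hκ : ∀ b : PBond P i, |η b.src - η b.tgt| ≤ 1 / s := by
    intro b
    have hsplit : ∀ y : Site P i, η y = ψ ((y b.dir - x₀ b.dir).val) * ∏ k ∈ Finset.univ.erase b.dir, ψ ((y k - x₀ k).val) := by
      intro y
      simp only [hη]
      exact (Finset.mul_prod_erase Finset.univ (fun k => ψ ((y k - x₀ k).val)) (Finset.mem_univ _)).symm
    have hrest : ∏ k ∈ Finset.univ.erase b.dir, ψ ((b.tgt k - x₀ k).val) = ∏ k ∈ Finset.univ.erase b.dir, ψ ((b.src k - x₀ k).val) := by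
      refine Finset.prod_congr rfl fun k hk => ?_
      rw [hoff_ne b k (Finset.ne_of_mem_erase hk)]
    have hR0 : 0 ≤ ∏ k ∈ Finset.univ.erase b.dir, ψ ((b.src k - x₀ k).val) := Finset.prod_nonneg fun k _ => hψ0 _
    have hR1 : ∏ k ∈ Finset.univ.erase b.dir, ψ ((b.src k - x₀ k).val) ≤ 1 := Finset.prod_le_one (fun k _ => hψ0 _) fun k _ => hψ1 _
    rw [hsplit b.src, hsplit b.tgt, hrest, ← sub_mul, abs_mul, abs_of_nonneg hR0]
    calc _ ≤ 1 / (s : ℝ) * 1 := mul_le_mul (hψstep b) hR1 hR0 (by positivity)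
      _ = 1 / s := mul_one _
  have hopen : ∀ y : Site P i, η y ≠ 0 → ∀ k, a < (y k - x₀ k).val ∧ (y k - x₀ k).val < c := by
    intro y hy k
    by_contra hcon
    apply hy
    simp only [hη]
    apply Finset.prod_eq_zero (Finset.mem_univ k)
    rcases not_and_or.mp hcon with h1 | h1
    · exact clamp_eq_zero_of_le a c hs0 (not_lt.mp h1)
    · exact clamp_eq_zero_of_ge a c hs0 (not_lt.mp h1)
  -- the box bonds inside the graph `↥S`
  set D : Finset ↥S := Finset.univ.filter (fun b : ↥S => (∀ k, (b.1.src k - x₀ k).val < n) ∧ ∀ k, (b.1.tgt k - x₀ k).val < n) with hD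
  have hDN : D.card ≤ P.d * n ^ P.d := by
    have hsub : D.map ⟨(Subtype.val : ↥S → PBond P i), Subtype.val_injective⟩ ⊆
        Finset.univ.filter (fun b : PBond P i => ∀ k, (b.src k - x₀ k).val < n) := by
      intro b hb
      rw [Finset.mem_map] at hb
      obtain ⟨b', hb', rfl⟩ := hb
      rw [hD, Finset.mem_filter] at hb'
      exact Finset.mem_filter.mpr ⟨Finset.mem_univ _, hb'.2.1⟩
    calc D.card = (D.map ⟨(Subtype.val : ↥S → PBond P i), Subtype.val_injective⟩).card := (Finset.card_map _).symm
      _ ≤ (Finset.univ.filter (fun b : PBond P i => ∀ k, (b.src k - x₀ k).val < n)).card := Finset.card_le_card hsub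
      _ ≤ P.d * n ^ P.d := card_filter_bond_box_le x₀ n
  have hDsupp : ∀ b : ↥S, b ∉ D → η b.1.src = 0 ∧ η b.1.tgt = 0 := by
    intro b hb
    by_contra hcon
    apply hb
    rw [hD, Finset.mem_filter]
    refine ⟨Finset.mem_univ _, ?_⟩
    rcases not_and_or.mp hcon with h1 | h1
    · have ho := hopen _ h1
      refine ⟨fun k => by have := (ho k).2; omega, fun k => ?_⟩
      by_cases hk : k = b.1.dir
      · subst hk
        rw [hoff_dir]
        have := (ho b.1.dir).2
        split_ifs <;> omega
      · rw [hoff_ne b.1 k hk]; have := (ho k).2; omega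
    · have ho := hopen _ h1
      refine ⟨fun k => ?_, fun k => by have := (ho k).2; omega⟩
      by_cases hk : k = b.1.dir
      · subst hk
        have h3 := hoff_dir b.1
        have h4 := (ho b.1.dir).1
        have h5 := (ho b.1.dir).2
        split_ifs at h3 with hlt
        · omega
        · omega
      · rw [← hoff_ne b.1 k hk]; have := (ho k).2; omega
  have hδD : ∀ b ∈ D, ∑ a' : Fin 4, ∑ i' : Fin 4, (Sm b.1 a' i' - (1 : Matrix (Fin 4) (Fin 4) ℝ) a' i') ^ 2 ≤ (4 * C) ^ 2 := by
    intro b hb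
    rw [hD, Finset.mem_filter] at hb
    have h1 := pow_le_pow_left₀ (GaugeGroup.dist1_nonneg _) (hbondV b.1 hb.2.1 hb.2.2) 2
    have h2 := pow_le_pow_left₀ (GaugeGroup.dist1_nonneg _) (hbondW b.1 hb.2.1 hb.2.2) 2
    calc _ ≤ 8 * (GaugeGroup.dist1 (GaugeField.gaugeAct g₁ V b.1) ^ 2 + GaugeGroup.dist1 (GaugeField.gaugeAct g₂ W b.1) ^ 2) := hdef b.1
      _ ≤ 8 * (C ^ 2 + C ^ 2) := by linarith
      _ = (4 * C) ^ 2 := by ring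
  -- the plateau inside the graph `↥S`
  set A : Finset ↥S := Finset.univ.filter (fun b : ↥S => ∀ k, a + s ≤ (b.1.src k - x₀ k).val ∧ (b.1.src k - x₀ k).val + s ≤ c ∧
        a + s ≤ (b.1.tgt k - x₀ k).val ∧ (b.1.tgt k - x₀ k).val + s ≤ c) with hA
  have hA1 : ∀ b ∈ A, η b.1.src = 1 ∧ η b.1.tgt = 1 := by
    intro b hb
    rw [hA, Finset.mem_filter] at hb
    have hp := hb.2
    refine ⟨?_, ?_⟩
    · simp only [hη]
      refine Finset.prod_eq_one fun k _ => clamp_eq_one a c hs0 ?_ ?_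
      · exact_mod_cast (hp k).1
      · exact_mod_cast (hp k).2.1
    · simp only [hη]
      refine Finset.prod_eq_one fun k _ => clamp_eq_one a c hs0 ?_ ?_
      · exact_mod_cast (hp k).2.2.1
      · exact_mod_cast (hp k).2.2.2
  have hu : ∀ x : Site P i, dotProduct ![(((h' x : Matrix.specialUnitaryGroup (Fin 2) ℂ) : Matrix (Fin 2) (Fin 2) ℂ) 0 0).re, (((h' x : Matrix.specialUnitaryGroup (Fin 2) ℂ) : Matrix (Fin 2) (Fin 2) ℂ) 0 0).im, (((h' x : Matrix.specialUnitaryGroup (Fin 2) ℂ) : Matrix (Fin 2) (Fin 2) ℂ) 1 0).re, (((h' x : Matrix.specialUnitaryGroup (Fin 2) ℂ) : Matrix (Fin 2) (Fin 2) ℂ) 1 0).im] ![(((h' x : Matrix.specialUnitaryGroup (Fin 2) ℂ) : Matrix (Fin 2) (Fin 2) ℂ) 0 0).re, (((h' x : Matrix.specialUnitaryGroup (Fin 2) ℂ) : Matrix (Fin 2) (Fin 2) ℂ) 0 0).im, (((h' x : Matrix.specialUnitaryGroup (Fin 2) ℂ) : Matrix (Fin 2) (Fin 2) ℂ) 1 0).re,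 (((h' x : Matrix.specialUnitaryGroup (Fin 2) ℂ) : Matrix (Fin 2) (Fin 2) ℂ) 1 0).im] = 1 := fun x => coords_dot_self (h' x)
  -- (5) ★w8's growth bound on the graph `↥S`
  have H := sum_energy_le_of_cutoff (fun b : ↥S => b.1.src) (fun b : ↥S => b.1.tgt) (fun x => ![(((h' x : Matrix.specialUnitaryGroup (Fin 2) ℂ) : Matrix (Fin 2) (Fin 2) ℂ) 0 0).re, (((h' x : Matrix.specialUnitaryGroup (Fin 2) ℂ) : Matrix (Fin 2) (Fin 2) ℂ) 0 0).im, (((h' x : Matrix.specialUnitaryGroup (Fin 2) ℂ) : Matrix (Fin 2) (Fin 2) ℂ) 1 0).re, (((h' x : Matrix.specialUnitaryGroup (Fin 2) ℂ) : Matrix (Fin 2) (Fin 2) ℂ) 1 0).im]) hu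
    (fun b : ↥S => Sm b.1) (fun b => hSm b.1) η hη0 hη1 (hLX η) D hDN hDsupp (fun b => hκ b.1) hδD A hA1
  -- (6) read the plateau energy back in the original gauge
  have hterm : ∀ b : ↥S, dotProduct (![(((h' b.1.src : Matrix.specialUnitaryGroup (Fin 2) ℂ) : Matrix (Fin 2) (Fin 2) ℂ) 0 0).re, (((h' b.1.src : Matrix.specialUnitaryGroup (Fin 2) ℂ) : Matrix (Fin 2) (Fin 2) ℂ) 0 0).im, (((h' b.1.src : Matrix.specialUnitaryGroup (Fin 2) ℂ) : Matrix (Fin 2) (Fin 2) ℂ) 1 0).re, (((h' b.1.src : Matrix.specialUnitaryGroup (Fin 2) ℂ) : Matrix (Fin 2) (Fin 2) ℂ) 1 0).im] - (Sm b.1)ᵀ *ᵥ ![(((h' b.1.tgt : Matrix.specialUnitaryGroup (Fin 2) ℂ) : Matrix (Fin 2) (Fin 2) ℂ) 0 0).re, (((h' b.1.tgt : Matrix.specialUnitaryGroup (Fin 2) ℂ) : Matrix (Fin 2) (Fin 2) ℂ) 0 0).im, (((h' b.1.tgt : Matrix.specialUnitaryGroup (Fin 2) ℂ) : Matrix (Fin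 2) (Fin 2) ℂ) 1 0).re, (((h' b.1.tgt : Matrix.specialUnitaryGroup (Fin 2) ℂ) : Matrix (Fin 2) (Fin 2) ℂ) 1 0).im]) (![(((h' b.1.src : Matrix.specialUnitaryGroup (Fin 2) ℂ) : Matrix (Fin 2) (Fin 2) ℂ) 0 0).re, (((h' b.1.src : Matrix.specialUnitaryGroup (Fin 2) ℂ) : Matrix (Fin 2) (Fin 2) ℂ) 0 0).im, (((h' b.1.src : Matrix.specialUnitaryGroup (Fin 2) ℂ) : Matrix (Fin 2) (Fin 2) ℂ) 1 0).re, (((h' b.1.src : Matrix.specialUnitaryGroup (Fin 2) ℂ) : Matrix (Fin 2) (Fin 2) ℂ) 1 0).im] - (Sm b.1)ᵀ *ᵥ ![(((h' b.1.tgt : Matrix.specialUnitaryGroup (Fin 2) ℂ) : Matrix (Fin 2) (Fin 2) ℂ) 0 0).re, (((h' b.1.tgt : Matrix.specialUnitaryGroup (Fin 2) ℂ) : Matrix (Fin 2) (Fin 2) ℂ) 0 0).im, (((h' b.1.tgt : Matrix.specialUnitaryGroup (Fin 2) ℂ) : Matrix (Fin 2) (Fin 2) ℂ) 1 0).re, (((h'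 b.1.tgt : Matrix.specialUnitaryGroup (Fin 2) ℂ) : Matrix (Fin 2) (Fin 2) ℂ) 1 0).im]) =
      GaugeGroup.dist1 (V b.1 * (GaugeField.gaugeAct h W b.1)⁻¹) ^ 2 := by
    intro b
    rw [← dist1_regauge_one g₁ g₂ h V W b.1]
    exact (hE b.1).symm
  have hsumA : ∑ b ∈ A, GaugeGroup.dist1 (V b.1 * (GaugeField.gaugeAct h W b.1)⁻¹) ^ 2 =
      ∑ b ∈ S.filter (fun b => ∀ k, a + s ≤ (b.src k - x₀ k).val ∧ (b.src k - x₀ k).val + s ≤ c ∧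
        a + s ≤ (b.tgt k - x₀ k).val ∧ (b.tgt k - x₀ k).val + s ≤ c), GaugeGroup.dist1 (V b * (GaugeField.gaugeAct h W b)⁻¹) ^ 2 := by
    rw [hA, Finset.sum_filter, Finset.sum_filter]
    exact Finset.sum_coe_sort S (fun b => if (∀ k, a + s ≤ (b.src k - x₀ k).val ∧ (b.src k - x₀ k).val + s ≤ c ∧
        a + s ≤ (b.tgt k - x₀ k).val ∧ (b.tgt k - x₀ k).val + s ≤ c) then GaugeGroup.dist1 (V b * (GaugeField.gaugeAct h W b)⁻¹) ^ 2 else 0)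
  refine le_trans (le_of_eq ?_) H
  rw [← hsumA]
  exact Finset.sum_congr rfl fun b _ => (hterm b).symm

/-! ## §3 Exports for the final knit (v1.1 append): regauged minimality and the axial box gauge, by name -/

/-- **REGAUGED MINIMALITY** (v1.1 export of §2's step (2)): if `h` minimises the box-`ℓ²` orbit energy of `(V, W)` over `S`, then `g₁hg₂⁻¹` minimises
that of `(V^{g₁}, W^{g₂})` over `S`, for ANY gauge transformations `g₁, g₂` (bondwise conjugation, §1) — so the flat shadow
(✓`PoincareLipschitzOrbitMinFlatShadow.exists_flatShadow`) may be taken in the axial box gauge, where the twists are `θ`-close to `1`. [cite: Balaban1985Averaging, (8) p.19] -/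
theorem orbitMin_regauge [DecidableEq (PBond P i)]
    (V W : GaugeField P i (Matrix.specialUnitaryGroup (Fin 2) ℂ)) (S : Finset (PBond P i))
    (h : GaugeTransf P i (Matrix.specialUnitaryGroup (Fin 2) ℂ))
    (hmin : ∀ k' : GaugeTransf P i (Matrix.specialUnitaryGroup (Fin 2) ℂ),
      (∑ b : PBond P i, if b ∈ S then GaugeGroup.dist1 (V b * (GaugeField.gaugeAct h W b)⁻¹) ^ 2 else 0) ≤
        ∑ b : PBond P i, if b ∈ S then GaugeGroup.dist1 (V b * (GaugeField.gaugeAct k' (GaugeField.gaugeAct h W) b)⁻¹) ^ 2 else 0)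
    (g₁ g₂ : GaugeTransf P i (Matrix.specialUnitaryGroup (Fin 2) ℂ)) :
    ∀ k' : GaugeTransf P i (Matrix.specialUnitaryGroup (Fin 2) ℂ),
      (∑ b : PBond P i, if b ∈ S then GaugeGroup.dist1 (GaugeField.gaugeAct g₁ V b *
          (GaugeField.gaugeAct (fun x => g₁ x * h x * (g₂ x)⁻¹) (GaugeField.gaugeAct g₂ W) b)⁻¹) ^ 2 else 0) ≤
        ∑ b : PBond P i, if b ∈ S then GaugeGroup.dist1 (GaugeField.gaugeAct g₁ V b *
          (GaugeField.gaugeAct k' (GaugeField.gaugeAct (fun x => g₁ x * h x * (g₂ x)⁻¹) (GaugeField.gaugeAct g₂ W)) b)⁻¹) ^ 2 else 0 := by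
  intro k'
  simp only [dist1_regauge_one g₁ g₂ h V W, dist1_regauge g₁ g₂ h k' V W]
  exact hmin _

/-- **THE AXIAL BOX GAUGE, BY NAME** (v1.1 export of §2's step (1)): if every plaquette based in the K1 box `{(y_k − x₀_k).val < n}` (`1 ≤ n`,
`2n ≤ sitesPerDir`) is `δ`-small, then in the axial gauge of the integer box `[lo, lo + (n−1)]`, `lo_k = (x₀_k).val` (lit ✓`T4AxialGaugeSmallField.axialGauge`),
every bond with both endpoints in the K1 box is within `(d−1)(n−1)δ` of `1`. [cite: Balaban1985Averaging, (19)-(20) p.21] -/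
theorem dist1_gaugeAct_axialGauge_box_le {G : Type*} [GaugeGroup G] (V : GaugeField P i G) (x₀ : Site P i) {n : ℕ} (hn : 1 ≤ n)
    (h2n : 2 * n ≤ P.sitesPerDir i) {δ : ℝ} (hδ : 0 ≤ δ)
    (hV : ∀ q : Plaq P i, (∀ k, (q.src k - x₀ k).val < n) → GaugeGroup.dist1 (GaugeField.plaqHol V q) < δ)
    (b : PBond P i) (hsb : ∀ k, (b.src k - x₀ k).val < n) (htb : ∀ k, (b.tgt k - x₀ k).val < n) :
    GaugeGroup.dist1 (GaugeField.gaugeAct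
        (axialGauge V (fun κ => ((x₀ κ).val : ℤ)) (fun κ => ((x₀ κ).val : ℤ) + ((n - 1 : ℕ) : ℤ))) V b) ≤
      (((P.d - 1 : ℕ) : ℝ)) * (((n - 1 : ℕ) : ℝ)) * δ := by
  have hnle : ∀ κ : Fin P.d, (fun κ => ((x₀ κ).val : ℤ) + ((n - 1 : ℕ) : ℤ)) κ ≤ (fun κ => ((x₀ κ).val : ℤ)) κ + ((n - 1 : ℕ) : ℤ) :=
    fun κ => le_rfl
  have hnN : n - 1 < P.sitesPerDir i := by omega
  have hsmall : PlaqSmallOn (boxPlaqs (fun κ => ((x₀ κ).val : ℤ)) (fun κ => ((x₀ κ).val : ℤ) + ((n - 1 : ℕ) : ℤ))) δ V :=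
    fun q hq => hV q (val_lt_of_mem_boxPlaqs x₀ hn h2n hq)
  have h0 := dist1_gaugeAct_axialGauge_le_of_mem_boxBonds V subset_rfl hsmall hδ hnle hnN (mem_boxBonds_of_val_lt x₀ hn h2n b hsb htb)
  simpa [mul_assoc] using h0

end Summit.QuantumFields.YangMills.Theorems.PoincareLipschitzOrbitMinBoxEnergy

end
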